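import Summits.QuantumFields.YangMills.Theorems.SwapVirialDeficitZeroModeGroupThreeScaling
import HarnessLib

/-!
# Exact zero-mode rung on the GROUP, three letters — IV: the rescaled integrand, its β-free Gaussian dominator and its pointwise limit
# (rung Z4 in Laplace form; LEAD ym-line-sfw-p2 g93's «exact zero-mode asymptotics»; free-hands support of ⟨stmt-QuantumFields-24197⟩)

At an axis hub `a = a₀ + r·i` (`a_J = a_K = 0`, `‖a‖ ≤ 1`) and with `s = t² = β⁻¹`, part III turned `β²ψ_β(a)` into `coneConst²·∫∫ h_s(x, y) dx dy` with the
EXPLICIT integrand (§1, `hsc`)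
`h_s(x,y) = 𝟙{N_s(x) < 1}·𝟙{N_s(y) < 1}·exp(−E_s(x,y))`, `N_s(x) = x₀² + x_I² + s(x_J² + x_K²)`,
`E_s = 4[(x_Ky_I − x_Iy_K)² + (x_Iy_J − x_Jy_I)² + s(x_Jy_K − x_Ky_J)²]/(N_s(x)N_s(y)) + 4r²(x_J²+x_K²)/(N_s(x)‖a‖²) + 4r²(y_J²+y_K²)/(N_s(y)‖a‖²)`
(★ `sq_mul_psiCone_eq_lintegral_hsc`).  This file proves the two pointwise inputs of dominated convergence:
* §2 ★★ `hsc_le_dominator` — for `s > 0`: `h_s ≤ G`, `G(x,y) = 𝟙{x₀²+x_I² < 1}𝟙{y₀²+y_I² < 1}·exp(−4[r²(x_J²+x_K²+y_J²+y_K²) + (x_Ky_I − x_Iy_K)² + (x_Iy_J − x_Jy_I)²])`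
  (all denominators lie in `[0,1]`, and vanish only together with their numerators) — β-FREE;
* §3 ★★ `tendsto_hsc` — for every `(x,y)` off the null set `{x₀ = x_I = 0} ∪ {y₀ = y_I = 0}` and `‖a‖ ≠ 0`: `h_s(x,y) → h_0(x,y)` as `s → 0⁺`
  (the ball indicators converge EVERYWHERE: `N_s ↓ N_0`).
Part V: `∫∫∫ G < ∞` (the exact coupled 2×2 Gaussian `π²/(16r²(r²+x_I²+y_I²))` and AM–GM — the no-log mechanism) and the limit theorem.
HONEST LABEL: finite-dimensional real analysis (plan-level zero-mode rung); NOT the fixed-`L` sharp law, NOT ⟨24197⟩; the Yang–Mills mass gap is NOT proved;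
no summit is proved by a line.  Width seat ym-line-sfw-p2-w2 g55 (cell ym-idea-1, free hands; own crux ⟨22884⟩ blocked-on ⟨19935⟩),
`--supports stmt-QuantumFields-24197`.  Standard axioms, 0 `sorry`; the three local instances of the ToronLog files.
References: [cite: GonzalezarroyoAltes1988]; [cite: Vanbaal2001]; [folklore].
-/

set_option autoImplicit false

noncomputable section

open MeasureTheory Quaternion Set Filter Topology
open scoped Quaternion ENNReal BigOperators
open Literature.MathematicalPhysics.QuantumLattice
open Literature.MathematicalPhysics.QuantumFieldTheory (haarProbability)
open Summit.QuantumFields.YangMills.Theorems.SwapTwistDeficit.ToronLog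

attribute [local instance] Literature.Analysis.FluidPDE.Tao2016.quatMeasurableSpace
  Literature.Analysis.FluidPDE.Tao2016.quatBorelSpace
  Literature.MathematicalPhysics.QuantumLattice.secondCountableTopology_su2

namespace Summit.QuantumFields.YangMills.Theorems.SwapVirialDeficit.ZeroModeGroup

/-! ## §1 The rescaled integrand `h_s` -/

/-- The rescaled squared norm `N_s(x) = x₀² + x_I² + s(x_J² + x_K²)` (`= ‖D_t x‖²` at `s = t²`). [folklore] -/
def nsc (s : ℝ) (x : ℍ) : ℝ := x.re ^ 2 + x.imI ^ 2 + s * (x.imJ ^ 2 + x.imK ^ 2)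

/-- The rescaled exponent `E_s` at an axis hub with parameters `(A, r) = (‖a‖², a_I)`. [folklore] -/
def esc (s A r : ℝ) (x y : ℍ) : ℝ :=
  4 * ((x.imK * y.imI - x.imI * y.imK) ^ 2 + (x.imI * y.imJ - x.imJ * y.imI) ^ 2 + s * (x.imJ * y.imK - x.imK * y.imJ) ^ 2) / (nsc s x * nsc s y) +
    4 * (r ^ 2 * (x.imJ ^ 2 + x.imK ^ 2)) / (nsc s x * A) + 4 * (r ^ 2 * (y.imJ ^ 2 + y.imK ^ 2)) / (nsc s y * A)

/-- The rescaled integrand `h_s(x,y) = 𝟙{N_s(x) < 1}𝟙{N_s(y) < 1}·e^{−E_s(x,y)}` (as `ℝ≥0∞`). [folklore] -/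
def hsc (s A r : ℝ) (x y : ℍ) : ℝ≥0∞ :=
  ({x : ℍ | nsc s x < 1}.indicator (fun _ => (1 : ℝ≥0∞)) x) * ({y : ℍ | nsc s y < 1}.indicator (fun _ => (1 : ℝ≥0∞)) y) *
    ENNReal.ofReal (Real.exp (-(esc s A r x y)))

/-- The β-free dominator `G(x,y) = 𝟙{x₀²+x_I² < 1}𝟙{y₀²+y_I² < 1}·exp(−4[r²(x_J²+x_K²+y_J²+y_K²) + (x_Ky_I − x_Iy_K)² + (x_Iy_J − x_Jy_I)²])`. [folklore] -/
def dominator (r : ℝ) (x y : ℍ) : ℝ≥0∞ :=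
  ({x : ℍ | x.re ^ 2 + x.imI ^ 2 < 1}.indicator (fun _ => (1 : ℝ≥0∞)) x) * ({y : ℍ | y.re ^ 2 + y.imI ^ 2 < 1}.indicator (fun _ => (1 : ℝ≥0∞)) y) *
    ENNReal.ofReal (Real.exp (-(4 * (r ^ 2 * (x.imJ ^ 2 + x.imK ^ 2 + y.imJ ^ 2 + y.imK ^ 2) +
      ((x.imK * y.imI - x.imI * y.imK) ^ 2 + (x.imI * y.imJ - x.imJ * y.imI) ^ 2)))))

/-- Unfolding lemmas (the definitions are made irreducible below). [folklore] -/
theorem nsc_def (s : ℝ) (x : ℍ) : nsc s x = x.re ^ 2 + x.imI ^ 2 + s * (x.imJ ^ 2 + x.imK ^ 2) := rfl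

/-- Unfolding `esc`. [folklore] -/
theorem esc_def (s A r : ℝ) (x y : ℍ) : esc s A r x y =
    4 * ((x.imK * y.imI - x.imI * y.imK) ^ 2 + (x.imI * y.imJ - x.imJ * y.imI) ^ 2 + s * (x.imJ * y.imK - x.imK * y.imJ) ^ 2) / (nsc s x * nsc s y) +
      4 * (r ^ 2 * (x.imJ ^ 2 + x.imK ^ 2)) / (nsc s x * A) + 4 * (r ^ 2 * (y.imJ ^ 2 + y.imK ^ 2)) / (nsc s y * A) := rfl

/-- Unfolding `hsc`. [folklore] -/
theorem hsc_def (s A r : ℝ) (x y : ℍ) : hsc s A r x y =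
    ({x : ℍ | nsc s x < 1}.indicator (fun _ => (1 : ℝ≥0∞)) x) * ({y : ℍ | nsc s y < 1}.indicator (fun _ => (1 : ℝ≥0∞)) y) *
      ENNReal.ofReal (Real.exp (-(esc s A r x y))) := rfl

/-- Unfolding `dominator`. [folklore] -/
theorem dominator_def (r : ℝ) (x y : ℍ) : dominator r x y =
    ({x : ℍ | x.re ^ 2 + x.imI ^ 2 < 1}.indicator (fun _ => (1 : ℝ≥0∞)) x) * ({y : ℍ | y.re ^ 2 + y.imI ^ 2 < 1}.indicator (fun _ => (1 : ℝ≥0∞)) y) *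
      ENNReal.ofReal (Real.exp (-(4 * (r ^ 2 * (x.imJ ^ 2 + x.imK ^ 2 + y.imJ ^ 2 + y.imK ^ 2) +
        ((x.imK * y.imI - x.imI * y.imK) ^ 2 + (x.imI * y.imJ - x.imJ * y.imI) ^ 2))))) := rfl

/-- `N_s(x) = ‖D_t x‖²` at `s = t²`. [folklore] -/
theorem nsc_sq_eq_norm_sq_dilate (t : ℝ) (x : ℍ) : nsc (t ^ 2) x = ‖dilate t x‖ ^ 2 := by
  rw [nsc_def, norm_sq_dilate]

/-- `N_s(x) ≥ x₀² + x_I² = N_0(x)` for `s ≥ 0`, and `N_s` is monotone in `s`. [folklore] -/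
theorem nsc_mono {s s' : ℝ} (h : s ≤ s') (x : ℍ) : nsc s x ≤ nsc s' x := by
  rw [nsc_def, nsc_def]; nlinarith [sq_nonneg x.imJ, sq_nonneg x.imK]

/-- `N_s(x) ≥ 0` for `s ≥ 0`. [folklore] -/
theorem nsc_nonneg {s : ℝ} (hs : 0 ≤ s) (x : ℍ) : 0 ≤ nsc s x := by rw [nsc_def]; positivity

/-- `N_0(x) = x₀² + x_I²`. [folklore] -/
theorem nsc_zero (x : ℍ) : nsc 0 x = x.re ^ 2 + x.imI ^ 2 := by rw [nsc_def]; ring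

/-- ★ **The link with part III**: for `β > 0` and an axis hub `a` (`a_J = a_K = 0`), the integrand of ✓`sq_mul_psiCone_eq` IS `h_{β⁻¹}` with
`(A, r) = (‖a‖², a_I)`: `𝟙_B(D_tx)·(𝟙_B(D_ty)·e^{−β·blockThree(D_tx, D_ty, a)}) = h_{β⁻¹}(x, y)`, `t = (√β)⁻¹`. [folklore] -/
theorem indicator_dilate_eq_hsc {β : ℝ} (hβ : 0 < β) (a : ℍ) (hJ : a.imJ = 0) (hK : a.imK = 0) (x y : ℍ) :
    (Metric.ball (0 : ℍ) 1).indicator (fun z => (Metric.ball (0 : ℍ) 1).indicator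
        (fun w => ENNReal.ofReal (Real.exp (-(β * blockThree z w a)))) (dilate (Real.sqrt β)⁻¹ y)) (dilate (Real.sqrt β)⁻¹ x) =
      hsc β⁻¹ (‖a‖ ^ 2) a.imI x y := by
  set t : ℝ := (Real.sqrt β)⁻¹ with ht_def
  have ht2 : t ^ 2 = β⁻¹ := by rw [ht_def, inv_pow, Real.sq_sqrt hβ.le]
  -- ball membership through `N`
  have hball : ∀ z : ℍ, dilate t z ∈ Metric.ball (0 : ℍ) 1 ↔ nsc β⁻¹ z < 1 := by
    intro z
    rw [Metric.mem_ball, dist_zero_right, ← ht2, nsc_sq_eq_norm_sq_dilate]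
    constructor
    · intro h; nlinarith [norm_nonneg (dilate t z)]
    · intro h
      by_contra hc
      push Not at hc
      nlinarith [norm_nonneg (dilate t z)]
  -- the exponent
  have hexp : β * blockThree (dilate t x) (dilate t y) a = esc β⁻¹ (‖a‖ ^ 2) a.imI x y := by
    rw [ht_def, mul_blockThree_dilate hβ a hJ hK, esc_def, nsc_def, nsc_def, norm_sq_axis a hJ hK, ← ht_def, ht2]
  rw [hsc_def]
  by_cases hx : dilate t x ∈ Metric.ball (0 : ℍ) 1
  · by_cases hy : dilate t y ∈ Metric.ball (0 : ℍ) 1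
    · rw [Set.indicator_of_mem hx, Set.indicator_of_mem hy, Set.indicator_of_mem (show x ∈ {x : ℍ | nsc β⁻¹ x < 1} from (hball x).1 hx),
        Set.indicator_of_mem (show y ∈ {y : ℍ | nsc β⁻¹ y < 1} from (hball y).1 hy), one_mul, one_mul, hexp]
    · rw [Set.indicator_of_mem hx, Set.indicator_of_notMem hy,
        Set.indicator_of_notMem (show y ∉ {y : ℍ | nsc β⁻¹ y < 1} from fun h => hy ((hball y).2 h)), mul_zero, zero_mul]
  · rw [Set.indicator_of_notMem hx, Set.indicator_of_notMem (show x ∉ {x : ℍ | nsc β⁻¹ x < 1} from fun h => hx ((hball x).2 h)),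
      zero_mul, zero_mul]

/-- ★ **`β²·ψ_β(a) = coneConst²·∫∫ h_{β⁻¹}`** for `β > 0` and an axis hub `a`. [folklore] -/
theorem sq_mul_psiCone_eq_lintegral_hsc {β : ℝ} (hβ : 0 < β) (a : ℍ) (hJ : a.imJ = 0) (hK : a.imK = 0) :
    ENNReal.ofReal (β ^ 2) * psiCone β a =
      ENNReal.ofReal coneConst * (ENNReal.ofReal coneConst * ∫⁻ x, ∫⁻ y, hsc β⁻¹ (‖a‖ ^ 2) a.imI x y) := by
  rw [sq_mul_psiCone_eq hβ a]
  congr 2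
  refine lintegral_congr fun x => ?_
  -- move the outer indicator inside and identify pointwise
  have hpt : ∀ y, (Metric.ball (0 : ℍ) 1).indicator (fun z => (Metric.ball (0 : ℍ) 1).indicator
      (fun w => ENNReal.ofReal (Real.exp (-(β * blockThree z w a)))) (dilate (Real.sqrt β)⁻¹ y)) (dilate (Real.sqrt β)⁻¹ x) =
      hsc β⁻¹ (‖a‖ ^ 2) a.imI x y := fun y => indicator_dilate_eq_hsc hβ a hJ hK x y
  by_cases hx : dilate (Real.sqrt β)⁻¹ x ∈ Metric.ball (0 : ℍ) 1
  · rw [Set.indicator_of_mem hx]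
    refine lintegral_congr fun y => ?_
    have h := hpt y
    rw [Set.indicator_of_mem hx] at h
    exact h
  · rw [Set.indicator_of_notMem hx]
    have h0 : ∀ y, hsc β⁻¹ (‖a‖ ^ 2) a.imI x y = 0 := by
      intro y; have h := hpt y; rw [Set.indicator_of_notMem hx] at h; exact h.symm
    simp_rw [h0, lintegral_const, zero_mul]

/-! ## §2 Domination by the β-free Gaussian -/

/-- `n ≤ n/d` when `0 ≤ n`, `0 ≤ d ≤ 1` and `d = 0 ⇒ n = 0`. [folklore] -/
theorem le_div_of_denom_le_one {n d : ℝ} (hn : 0 ≤ n) (hd0 : 0 ≤ d) (hd1 : d ≤ 1) (h : d = 0 → n = 0) : n ≤ n / d := by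
  rcases eq_or_lt_of_le hd0 with hd | hd
  · rw [← hd, h hd.symm, zero_div]
  · rw [le_div_iff₀ hd]; nlinarith

/-- ★★ **DOMINATION**: for `0 < s`, `0 ≤ A ≤ 1` and `A = 0 ⇒ r = 0`: `h_s(x,y) ≤ G(x,y)`. [folklore] -/
theorem hsc_le_dominator {s A r : ℝ} (hs : 0 < s) (hA0 : 0 ≤ A) (hA1 : A ≤ 1) (hAr : A = 0 → r = 0) (x y : ℍ) :
    hsc s A r x y ≤ dominator r x y := by
  rw [hsc_def, dominator_def]
  by_cases hx : nsc s x < 1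
  · by_cases hy : nsc s y < 1
    · have hx0 : 0 ≤ nsc s x := nsc_nonneg hs.le x
      have hy0 : 0 ≤ nsc s y := nsc_nonneg hs.le y
      have hxb : x.re ^ 2 + x.imI ^ 2 < 1 := lt_of_le_of_lt (by rw [← nsc_zero]; exact nsc_mono hs.le x) hx
      have hyb : y.re ^ 2 + y.imI ^ 2 < 1 := lt_of_le_of_lt (by rw [← nsc_zero]; exact nsc_mono hs.le y) hy
      rw [Set.indicator_of_mem (show x ∈ {x : ℍ | nsc s x < 1} from hx), Set.indicator_of_mem (show y ∈ {y : ℍ | nsc s y < 1} from hy),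
        Set.indicator_of_mem (show x ∈ {x : ℍ | x.re ^ 2 + x.imI ^ 2 < 1} from hxb),
        Set.indicator_of_mem (show y ∈ {y : ℍ | y.re ^ 2 + y.imI ^ 2 < 1} from hyb)]
      simp only [one_mul]
      refine ENNReal.ofReal_le_ofReal (Real.exp_le_exp.2 (neg_le_neg ?_))
      -- `E_s ≥` the β-free quadratic
      have hsq0 : ∀ u v : ℝ, u ^ 2 + v ^ 2 = 0 → u = 0 ∧ v = 0 := fun u v h => by
        constructor <;> nlinarith [sq_nonneg u, sq_nonneg v]
      have hN0 : ∀ z : ℍ, nsc s z = 0 → z.imI = 0 ∧ z.imJ = 0 ∧ z.imK = 0 := by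
        intro z h; rw [nsc_def] at h
        have hJK : s * (z.imJ ^ 2 + z.imK ^ 2) = 0 := by nlinarith [sq_nonneg z.re, sq_nonneg z.imI, sq_nonneg z.imJ, sq_nonneg z.imK]
        have hI : z.imI ^ 2 = 0 := by nlinarith [sq_nonneg z.re, sq_nonneg z.imI, sq_nonneg z.imJ, sq_nonneg z.imK]
        rcases mul_eq_zero.1 hJK with h2 | h2
        · exact absurd h2 hs.ne'
        · exact ⟨pow_eq_zero_iff (n := 2) (by norm_num) |>.1 hI, hsq0 _ _ h2⟩
      have hNx : nsc s x = 0 → x.imJ ^ 2 + x.imK ^ 2 = 0 := fun h => by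
        obtain ⟨-, hJ, hK⟩ := hN0 x h; rw [hJ, hK]; ring
      have hNy : nsc s y = 0 → y.imJ ^ 2 + y.imK ^ 2 = 0 := fun h => by
        obtain ⟨-, hJ, hK⟩ := hN0 y h; rw [hJ, hK]; ring
      -- term 1
      have h1 : 4 * ((x.imK * y.imI - x.imI * y.imK) ^ 2 + (x.imI * y.imJ - x.imJ * y.imI) ^ 2) ≤
          4 * ((x.imK * y.imI - x.imI * y.imK) ^ 2 + (x.imI * y.imJ - x.imJ * y.imI) ^ 2 + s * (x.imJ * y.imK - x.imK * y.imJ) ^ 2) /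
            (nsc s x * nsc s y) := by
        refine le_trans ?_ (le_div_of_denom_le_one (by positivity) (mul_nonneg hx0 hy0) (by nlinarith) ?_)
        · have : 0 ≤ s * (x.imJ * y.imK - x.imK * y.imJ) ^ 2 := by positivity
          linarith
        · intro h
          rcases mul_eq_zero.1 h with h | h
          · obtain ⟨hI, hJ, hK⟩ := hN0 x h; rw [hI, hJ, hK]; ring
          · obtain ⟨hI, hJ, hK⟩ := hN0 y h; rw [hI, hJ, hK]; ring
      -- terms 2 and 3
      have h2 : 4 * (r ^ 2 * (x.imJ ^ 2 + x.imK ^ 2)) ≤ 4 * (r ^ 2 * (x.imJ ^ 2 + x.imK ^ 2)) / (nsc s x * A) := by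
        refine le_div_of_denom_le_one (by positivity) (mul_nonneg hx0 hA0) (by nlinarith) ?_
        intro h
        rcases mul_eq_zero.1 h with h | h
        · rw [hNx h]; ring
        · rw [hAr h]; ring
      have h3 : 4 * (r ^ 2 * (y.imJ ^ 2 + y.imK ^ 2)) ≤ 4 * (r ^ 2 * (y.imJ ^ 2 + y.imK ^ 2)) / (nsc s y * A) := by
        refine le_div_of_denom_le_one (by positivity) (mul_nonneg hy0 hA0) (by nlinarith) ?_
        intro h
        rcases mul_eq_zero.1 h with h | h
        · rw [hNy h]; ring
        · rw [hAr h]; ring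
      rw [esc_def]
      linarith
    · rw [Set.indicator_of_notMem (show y ∉ {y : ℍ | nsc s y < 1} from hy), mul_zero, zero_mul]; exact bot_le
  · rw [Set.indicator_of_notMem (show x ∉ {x : ℍ | nsc s x < 1} from hx), zero_mul, zero_mul]; exact bot_le

/-! ## §3 Pointwise convergence as `s → 0⁺` -/

/-- The ball indicator converges everywhere: `𝟙{N_s(x) < 1} → 𝟙{N_0(x) < 1}` as `s → 0⁺`. [folklore] -/
theorem tendsto_indicator_nsc (x : ℍ) :
    Tendsto (fun s : ℝ => {x : ℍ | nsc s x < 1}.indicator (fun _ => (1 : ℝ≥0∞)) x) (𝓝[>] 0) (𝓝 ({x : ℍ | nsc 0 x < 1}.indicator (fun _ => (1 : ℝ≥0∞)) x)) := by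
  by_cases h0 : nsc 0 x < 1
  · -- eventually `N_s(x) < 1`
    have hcont : Tendsto (fun s : ℝ => nsc s x) (𝓝[>] 0) (𝓝 (nsc 0 x)) := by
      have hc : Continuous fun s : ℝ => nsc s x := by
        simp only [nsc_def]; fun_prop
      exact (hc.tendsto 0).mono_left nhdsWithin_le_nhds
    have hev : ∀ᶠ s in 𝓝[>] (0 : ℝ), nsc s x < 1 := hcont.eventually (Iio_mem_nhds h0)
    rw [Set.indicator_of_mem (show x ∈ {x : ℍ | nsc 0 x < 1} from h0)]
    refine tendsto_const_nhds.congr' ?_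
    filter_upwards [hev] with s hs
    rw [Set.indicator_of_mem (show x ∈ {x : ℍ | nsc s x < 1} from hs)]
  · -- never `N_s(x) < 1` for `s > 0`
    rw [Set.indicator_of_notMem (show x ∉ {x : ℍ | nsc 0 x < 1} from h0)]
    refine tendsto_const_nhds.congr' ?_
    filter_upwards [self_mem_nhdsWithin] with s hs
    have hs' : ¬ nsc s x < 1 := fun h => h0 (lt_of_le_of_lt (nsc_mono (le_of_lt hs) x) h)
    rw [Set.indicator_of_notMem (show x ∉ {x : ℍ | nsc s x < 1} from hs')]

/-- The rescaled exponent is continuous in `s` at `0` away from the null set `{N_0(x) = 0} ∪ {N_0(y) = 0}`. [folklore] -/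
theorem tendsto_esc {A r : ℝ} (x y : ℍ) (hx : nsc 0 x ≠ 0) (hy : nsc 0 y ≠ 0) :
    Tendsto (fun s : ℝ => esc s A r x y) (𝓝[>] 0) (𝓝 (esc 0 A r x y)) := by
  -- the three quotients `nᵢ(s)/dᵢ(s)` with polynomial `nᵢ, dᵢ` and `dᵢ(0) ≠ 0` (or `dᵢ ≡ 0`)
  have hNx : Continuous fun s : ℝ => nsc s x := by simp only [nsc_def]; fun_prop
  have hNy : Continuous fun s : ℝ => nsc s y := by simp only [nsc_def]; fun_prop
  have hn1 : Continuous fun s : ℝ => 4 * ((x.imK * y.imI - x.imI * y.imK) ^ 2 + (x.imI * y.imJ - x.imJ * y.imI) ^ 2 +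
      s * (x.imJ * y.imK - x.imK * y.imJ) ^ 2) := by fun_prop
  have h1 : ContinuousAt (fun s : ℝ => 4 * ((x.imK * y.imI - x.imI * y.imK) ^ 2 + (x.imI * y.imJ - x.imJ * y.imI) ^ 2 +
      s * (x.imJ * y.imK - x.imK * y.imJ) ^ 2) / (nsc s x * nsc s y)) 0 :=
    hn1.continuousAt.div (hNx.mul hNy).continuousAt (mul_ne_zero hx hy)
  have h2 : ContinuousAt (fun s : ℝ => 4 * (r ^ 2 * (x.imJ ^ 2 + x.imK ^ 2)) / (nsc s x * A)) 0 := by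
    by_cases hA : A = 0
    · simp only [hA, mul_zero, div_zero]; exact continuousAt_const
    · exact continuousAt_const.div (hNx.mul continuous_const).continuousAt (mul_ne_zero hx hA)
  have h3 : ContinuousAt (fun s : ℝ => 4 * (r ^ 2 * (y.imJ ^ 2 + y.imK ^ 2)) / (nsc s y * A)) 0 := by
    by_cases hA : A = 0
    · simp only [hA, mul_zero, div_zero]; exact continuousAt_const
    · exact continuousAt_const.div (hNy.mul continuous_const).continuousAt (mul_ne_zero hy hA)
  have hc : ContinuousAt (fun s : ℝ => esc s A r x y) 0 := by
    have e : (fun s : ℝ => esc s A r x y) = fun s => 4 * ((x.imK * y.imI - x.imI * y.imK) ^ 2 + (x.imI * y.imJ - x.imJ * y.imI) ^ 2 +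
        s * (x.imJ * y.imK - x.imK * y.imJ) ^ 2) / (nsc s x * nsc s y) + 4 * (r ^ 2 * (x.imJ ^ 2 + x.imK ^ 2)) / (nsc s x * A) +
        4 * (r ^ 2 * (y.imJ ^ 2 + y.imK ^ 2)) / (nsc s y * A) := by
      funext s; rw [esc_def]
    rw [e]
    exact (h1.add h2).add h3
  have := hc.tendsto
  rw [show esc 0 A r x y = (fun s : ℝ => esc s A r x y) 0 from rfl]
  exact this.mono_left nhdsWithin_le_nhds

/-- An indicator with values in `{0,1}` is finite. [folklore] -/
theorem indicator_one_ne_top (S : Set ℍ) (x : ℍ) : S.indicator (fun _ => (1 : ℝ≥0∞)) x ≠ ∞ := by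
  by_cases h : x ∈ S
  · rw [Set.indicator_of_mem h]; exact ENNReal.one_ne_top
  · rw [Set.indicator_of_notMem h]; exact ENNReal.zero_ne_top

/-- ★★ **POINTWISE LIMIT**: off the null set `{N_0(x) = 0} ∪ {N_0(y) = 0}`, `h_s(x,y) → h_0(x,y)` as `s → 0⁺`. [folklore] -/
theorem tendsto_hsc {A r : ℝ} (x y : ℍ) (hx : nsc 0 x ≠ 0) (hy : nsc 0 y ≠ 0) :
    Tendsto (fun s : ℝ => hsc s A r x y) (𝓝[>] 0) (𝓝 (hsc 0 A r x y)) := by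
  simp only [hsc_def]
  have hI := ENNReal.Tendsto.mul (tendsto_indicator_nsc x) (Or.inr (indicator_one_ne_top _ y)) (tendsto_indicator_nsc y)
    (Or.inr (indicator_one_ne_top _ x))
  have hE : Tendsto (fun s : ℝ => ENNReal.ofReal (Real.exp (-(esc s A r x y)))) (𝓝[>] 0) (𝓝 (ENNReal.ofReal (Real.exp (-(esc 0 A r x y))))) :=
    (ENNReal.continuous_ofReal.tendsto _).comp ((Real.continuous_exp.tendsto _).comp (tendsto_esc x y hx hy).neg)
  exact ENNReal.Tendsto.mul hI (Or.inr ENNReal.ofReal_ne_top) hE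
    (Or.inr (ENNReal.mul_ne_top (indicator_one_ne_top _ x) (indicator_one_ne_top _ y)))

attribute [irreducible] nsc
attribute [irreducible] esc
attribute [irreducible] hsc
attribute [irreducible] dominator

end Summit.QuantumFields.YangMills.Theorems.SwapVirialDeficit.ZeroModeGroup

end
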